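import Literature.Barriers.ValiantsHypothesis.MonotoneGapParseTrees
import Literature.Computability.AlgebraicComplexity.CircuitDepth
import Summits.ValiantsHypothesis.ValiantsHypothesis.Theorems.DivisionGapShadowDegreeSplitPencil

/-!
# `ShadowCofactorSplit` — the shadow bound for monotone formulas (helper file 1 of 2)

Route `route-ValiantsHypothesis-DivisionGap`, item `stmt-ValiantsHypothesis-15047`
(`ShadowCofactorSplit : ShadowBirkhoff → PerCofactorDegreeReduction → PerMultiplesHard`).

The Hrubeš–Yehudayoff shadow bound for monotone formulas (HrubesYehudayoff2021, Lemma 12 /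
Thm. 1: a monotone formula with `s` leaves computing `f` forces every planar projection of
`Newt(f)` to have `O(s)` vertices) is rendered, as in the tree's `BirkhoffShadowProofs.lean`
(HY21 Prop. 23), through *uniquely supported points of a pencil*: for an additive
`φ : (σ →₀ ℕ) →+ G` (in the application: exponent vector ↦ its image under a linear
`L : ℝ^{n×n} → ℝ²`) and additive `c d : G →+ ℝ`, the **pencil count** `SH[φ, c, d, f]` of
`f ∈ ℝ≥0[σ]` is the number of points of `φ(mon f)` that are the unique maximiser over `φ(mon f)`
of some functional `c + t·d`.  No definition is introduced: the count is the displayed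
`Set.ncard` expression (local notation).

* Part 1 — calculus of pencil counts over the semiring `ℝ≥0`, where supports are exact
  (`mon(f + g) = mon f ∪ mon g`, `mon(f·g) = mon f + mon g`: Jerrum–Snir positivity, tree file
  `MonotoneGapParseTrees.lean`): `0` counts `0`, monomials (`X i`, `C a`, `1`) at most `1`;
  subadditivity under `+`, `•`, `*` (`ncard_um_union_le`; `ncard_um_add_le` = the planar
  Minkowski step of HY21) and over the weighted list sums / list products of the gate semantics;
  monotonicity under a nonzero multiple along a separating pencil (`ncard_um_le_ncard_um_add`:
  a Minkowski summand has at most as many uniquely supported points).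
* Part 2 — **formulas** (`ArithCircuit.IsFormula`: every gate referenced at most once, junk
  references evaluate to `0`): the value of a fan-in-two formula of size `s` over `ℝ≥0` has
  pencil count `≤ 3s + 1` (`sh_eval_le`).  The tree structure is used through a potential
  argument along the gate list: with `R_i(j)` the number of references to gate `j` from the gates
  `≥ i` and the output and `N_j` the pencil count of gate `j`, `∑_{j<i} R_i(j)·N_j ≤ 3i`
  (`potential_le`), because a gate of fan-in `≤ 2` has `N ≤ 3 + ∑ (its references)·N`
  (`sh_gateVal_le`) and `R_{i+1}(i) ≤ 1` in a formula.

The sibling file `DivisionGapShadowCofactorSplit.lean` specialises to `φ = L ∘ (exponent vector)`,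
`f = per_n · h'`, and closes the item.

## References

* P. Hrubeš, A. Yehudayoff, *Shadows of Newton polytopes*, CCC 2021, LIPIcs 200:9, Lemma 12,
  Thm. 1, Thm. 42 [HrubesYehudayoff2021].
* M. Jerrum, M. Snir, *Some exact complexity results for straight-line computations over
  semirings*, J. ACM 29 (1982), §2.2 [JerrumSnir1982].
-/

noncomputable section

-- `Summit.ValiantsHypothesis.ValiantsHypothesis.…` is the tree's single-conjunct layout (Sub = Summit).
set_option linter.dupNamespace false

namespace Summit.ValiantsHypothesis.ValiantsHypothesis.Theorems.DivisionGap.ShadowCofactorSplit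

open scoped Pointwise NNReal
open MvPolynomial
open Literature.Computability.AlgebraicComplexity
open Literature.Barriers.ValiantsHypothesis.JerrumSnir
open Summit.ValiantsHypothesis.DivisionGap.ShadowDegreeSplit
open Summit.ValiantsHypothesis.Theorems.ShadowBirkhoffNegative

universe u v

variable {σ : Type u} {G : Type v} [AddCommGroup G] (φ : (σ →₀ ℕ) →+ G) (c d : G →+ ℝ)

local notation3 (prettyPrint := false) "UM[" c ", " d ", " X "]" =>
  {p | p ∈ X ∧ ∃ t : ℝ, ∀ q ∈ X, q ≠ p → c q + t * d q < c p + t * d p}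

local notation3 (prettyPrint := false) "PT[" φ ", " f "]" =>
  (⇑φ) '' ((MvPolynomial.support f : Finset _) : Set _)

local notation3 (prettyPrint := false) "SH[" φ ", " c ", " d ", " f "]" =>
  Set.ncard {p | p ∈ PT[φ, f] ∧ ∃ t : ℝ, ∀ q ∈ PT[φ, f], q ≠ p → c q + t * d q < c p + t * d p}

/-! ### Point sets of supports -/

/-- The image of the (finite) monomial set of a polynomial is finite. [folklore] -/
theorem finite_pts (f : MvPolynomial σ ℝ≥0) : (PT[φ, f]).Finite :=
  (Finset.finite_toSet _).image _

/-- The pencil count of the zero polynomial is `0` (empty monomial set). [folklore] -/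
theorem sh_zero : SH[φ, c, d, (0 : MvPolynomial σ ℝ≥0)] = 0 := by
  rw [support_zero, Finset.coe_empty, Set.image_empty]
  exact ncard_um_empty c d

/-- A polynomial with at most one monomial has pencil count at most `1`. [folklore] -/
theorem sh_le_one_of_subsingleton {f : MvPolynomial σ ℝ≥0}
    (h : ((f.support : Finset (σ →₀ ℕ)) : Set (σ →₀ ℕ)).Subsingleton) : SH[φ, c, d, f] ≤ 1 :=
  ncard_um_le_one c d (h.image _)

/-- A monomial has pencil count at most `1`. [folklore] -/
theorem sh_monomial_le (s : σ →₀ ℕ) (a : ℝ≥0) : SH[φ, c, d, monomial s a] ≤ 1 := by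
  refine sh_le_one_of_subsingleton φ c d ?_
  intro x hx y hy
  have hx' : x ∈ ({s} : Finset (σ →₀ ℕ)) := support_monomial_subset (Finset.mem_coe.1 hx)
  have hy' : y ∈ ({s} : Finset (σ →₀ ℕ)) := support_monomial_subset (Finset.mem_coe.1 hy)
  rw [Finset.mem_singleton] at hx' hy'
  rw [hx', hy']

/-- A variable has pencil count at most `1`. [folklore] -/
theorem sh_X_le (i : σ) : SH[φ, c, d, (X i : MvPolynomial σ ℝ≥0)] ≤ 1 :=
  sh_monomial_le φ c d (Finsupp.single i 1) 1

/-- A constant has pencil count at most `1`. [folklore] -/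
theorem sh_C_le (a : ℝ≥0) : SH[φ, c, d, (C a : MvPolynomial σ ℝ≥0)] ≤ 1 := by
  rw [C_apply]
  exact sh_monomial_le φ c d 0 a

/-- `1` has pencil count at most `1`. [folklore] -/
theorem sh_one_le : SH[φ, c, d, (1 : MvPolynomial σ ℝ≥0)] ≤ 1 := by
  rw [← C_1]
  exact sh_C_le φ c d 1

/-! ### Subadditivity (HY21 Lemma 12: unions and Minkowski sums only add) -/

/-- **Sums**: over `ℝ≥0`, `mon(f + g) = mon f ∪ mon g`, and uniquely supported points are
subadditive over unions. [cite: HrubesYehudayoff2021, Lemma 12] -/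
theorem sh_add_le [DecidableEq σ] (f g : MvPolynomial σ ℝ≥0) :
    SH[φ, c, d, f + g] ≤ SH[φ, c, d, f] + SH[φ, c, d, g] := by
  rw [support_add_eq, Finset.coe_union, Set.image_union]
  exact ncard_um_union_le c d _ _ (finite_pts φ f) (finite_pts φ g)

/-- **Scalars**: a scalar multiple has at most the pencil count of the polynomial (equal monomial
sets for a nonzero scalar, empty for zero). [folklore] -/
theorem sh_smul_le (a : ℝ≥0) (f : MvPolynomial σ ℝ≥0) :
    SH[φ, c, d, a • f] ≤ SH[φ, c, d, f] := by
  by_cases ha : a = 0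
  · subst ha
    rw [zero_smul, sh_zero]
    exact Nat.zero_le _
  · rw [support_smul_eq ha]

/-- **Products** (the planar Minkowski step): over `ℝ≥0`, `mon(f·g) = mon f + mon g`, `φ` is
additive, and uniquely supported points are subadditive over Minkowski sums
(`HrubesYehudayoff2021Prop23.ncard_um_add_le`). [cite: HrubesYehudayoff2021, Lemma 12] -/
theorem sh_mul_le [DecidableEq σ] (f g : MvPolynomial σ ℝ≥0) :
    SH[φ, c, d, f * g] ≤ SH[φ, c, d, f] + SH[φ, c, d, g] := by
  rw [support_mul_eq, Finset.coe_add, Set.image_add]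
  exact HrubesYehudayoff2021Prop23.ncard_um_add_le c d _ _ (finite_pts φ f) (finite_pts φ g)

/-- **A Minkowski summand has at most as many uniquely supported points** (HY21 Lemma 12, the
step `|vert Newt(f)| ≤ |vert Newt(f·h)|`): if `h ≠ 0` and the pencil `(c, d)` separates the points
of `G`, then the pencil count of `f` is at most that of `f · h`. [cite: HrubesYehudayoff2021, Lemma 12] -/
theorem sh_le_sh_mul [DecidableEq σ] (f h : MvPolynomial σ ℝ≥0) (hh : h ≠ 0)
    (hsep : ∀ b b' : G, c b = c b' → d b = d b' → b = b') :
    SH[φ, c, d, f] ≤ SH[φ, c, d, f * h] := by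
  rw [support_mul_eq, Finset.coe_add, Set.image_add]
  refine ncard_um_le_ncard_um_add c d _ _ (finite_pts φ f) (finite_pts φ h) ?_
    (fun b _ b' _ => hsep b b')
  exact (Finset.coe_nonempty.2 (support_nonempty.2 hh)).image _

/-! ### Lists (the gate semantics of `ArithCircuit`: weighted sums and products of operand lists) -/

/-- Pencil counts are subadditive over weighted list sums (and the empty sum `0` counts `0`);
stated for the shape `∑ a.1 • v a.2` of a sum gate of `ArithCircuit`. [folklore] -/
theorem sh_list_sum_smul_le [DecidableEq σ] {α : Type*} (l : List (ℝ≥0 × α))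
    (v : α → MvPolynomial σ ℝ≥0) :
    SH[φ, c, d, (l.map fun a => a.1 • v a.2).sum] ≤
      ((l.map Prod.snd).map fun x => SH[φ, c, d, v x]).sum := by
  induction l with
  | nil =>
    rw [List.map_nil, List.sum_nil, List.map_nil, List.map_nil, List.sum_nil, sh_zero]
  | cons a l ih =>
    rw [List.map_cons, List.sum_cons, List.map_cons, List.map_cons, List.sum_cons]
    exact (sh_add_le φ c d _ _).trans (add_le_add (sh_smul_le φ c d a.1 (v a.2)) ih)

/-- Pencil counts are subadditive over list products, up to `1` for the empty product; stated for
the shape `∏ v u` of a product gate of `ArithCircuit`. [folklore] -/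
theorem sh_list_prod_le [DecidableEq σ] {α : Type*} (l : List α) (v : α → MvPolynomial σ ℝ≥0) :
    SH[φ, c, d, (l.map v).prod] ≤ 1 + (l.map fun x => SH[φ, c, d, v x]).sum := by
  induction l with
  | nil =>
    rw [List.map_nil, List.prod_nil, List.map_nil, List.sum_nil, add_zero]
    exact sh_one_le φ c d
  | cons x l ih =>
    rw [List.map_cons, List.prod_cons, List.map_cons, List.sum_cons]
    calc SH[φ, c, d, v x * (l.map v).prod]
        ≤ SH[φ, c, d, v x] + SH[φ, c, d, (l.map v).prod] := sh_mul_le φ c d _ _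
      _ ≤ SH[φ, c, d, v x] + (1 + (l.map fun x => SH[φ, c, d, v x]).sum) := Nat.add_le_add_left ih _
      _ = 1 + (SH[φ, c, d, v x] + (l.map fun x => SH[φ, c, d, v x]).sum) := by ring


/-! ## Part 2. Monotone formulas: the pencil count of the output is at most `3·size + 1`

HY21 Lemma 12 / Thm. 1 for the tree's `ArithCircuit` formulas (`IsFormula`: every gate is
referenced at most once; junk references evaluate to `0`). Along the gate list we run a potential
argument: with `R_i(j)` the number of references to gate `j` from the gates `≥ i` and the output,
and `N_j` the pencil count of the value of gate `j`,
`Φ_i = ∑_{j<i} R_i(j)·N_j ≤ 3i` — a gate of fan-in `≤ 2` has `N ≤ 3 + ∑ (its references)·N`, and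
`R_{i+1}(i) ≤ 1` for a formula. At `i = size` only the output reference survives. -/

section Formula

open ArithCircuit (Gate Operand)

variable [DecidableEq σ] (gs : List (Gate ℝ≥0 σ))

omit [DecidableEq σ] in
/-- An operand read at position `i` counts at most `1 + ∑_{j<i} [it refers to j]·N_j`. [folklore] -/
theorem sh_opVal_le (i : ℕ) (u : Operand ℝ≥0 σ) :
    SH[φ, c, d, opVal gs i u] ≤
      1 + ∑ j ∈ Finset.range i, (if u.refersTo j then 1 else 0) * SH[φ, c, d, gateVal gs j] := by
  cases u with
  | var x =>
    refine (sh_X_le φ c d x).trans ?_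
    simp [Operand.refersTo]
  | const a =>
    refine (sh_C_le φ c d a).trans ?_
    simp [Operand.refersTo]
  | gate j' =>
    rw [opVal_gate]
    split_ifs with hj
    · have hsum : ∑ j ∈ Finset.range i,
          (if (Operand.gate j' : Operand ℝ≥0 σ).refersTo j then 1 else 0) * SH[φ, c, d, gateVal gs j]
            = SH[φ, c, d, gateVal gs j'] := by
        simp only [Operand.refersTo, beq_iff_eq]
        rw [Finset.sum_eq_single j']
        · simp
        · intro j _ hj'
          rw [if_neg (Ne.symm hj'), zero_mul]
        · intro h
          exact absurd (Finset.mem_range.2 hj) h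
      rw [hsum]
      exact Nat.le_add_left _ _
    · rw [sh_zero]
      exact Nat.zero_le _

omit [DecidableEq σ] in
/-- A list of operands read at position `i` counts at most `|list| + ∑_{j<i} (references to j)·N_j`.
[folklore] -/
theorem sum_sh_opVal_le (i : ℕ) (us : List (Operand ℝ≥0 σ)) :
    (us.map fun u => SH[φ, c, d, opVal gs i u]).sum ≤
      us.length + ∑ j ∈ Finset.range i, us.countP (Operand.refersTo j) * SH[φ, c, d, gateVal gs j] := by
  induction us with
  | nil => simp
  | cons u us ih =>
    rw [List.map_cons, List.sum_cons, List.length_cons]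
    have hu := sh_opVal_le φ c d gs i u
    have hc : ∀ j, (u :: us).countP (Operand.refersTo j) =
        us.countP (Operand.refersTo j) + (if u.refersTo j then 1 else 0) := fun j => List.countP_cons
    simp_rw [hc, add_mul, Finset.sum_add_distrib]
    omega

/-- **One gate** (fan-in `≤ 2`): `N_i ≤ 3 + ∑_{j<i} (references of gate i to j)·N_j`, by the
subadditivity of pencil counts over the gate's weighted sum / product. [cite: HrubesYehudayoff2021, Lemma 12] -/
theorem sh_gateVal_le {i : ℕ} {g : Gate ℝ≥0 σ} (hg : gs[i]? = some g) (hfan : g.fanIn ≤ 2) :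
    SH[φ, c, d, gateVal gs i] ≤
      3 + ∑ j ∈ Finset.range i, g.args.countP (Operand.refersTo j) * SH[φ, c, d, gateVal gs j] := by
  cases g with
  | sum args =>
    rw [gateVal_sum gs hg]
    have h1 := sh_list_sum_smul_le φ c d args (opVal gs i)
    have h2 := sum_sh_opVal_le φ c d gs i (args.map Prod.snd)
    have h3 : (args.map Prod.snd).length ≤ 2 := hfan
    change SH[φ, c, d, (args.map fun a => a.1 • opVal gs i a.2).sum] ≤
      3 + ∑ j ∈ Finset.range i, (args.map Prod.snd).countP (Operand.refersTo j) *
        SH[φ, c, d, gateVal gs j]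
    omega
  | prod args =>
    rw [gateVal_prod gs hg]
    have h1 := sh_list_prod_le φ c d args (opVal gs i)
    have h2 := sum_sh_opVal_le φ c d gs i args
    have h3 : args.length ≤ 2 := hfan
    change SH[φ, c, d, (args.map fun u => opVal gs i u).prod] ≤
      3 + ∑ j ∈ Finset.range i, args.countP (Operand.refersTo j) * SH[φ, c, d, gateVal gs j]
    have h1' : SH[φ, c, d, (args.map fun u => opVal gs i u).prod] ≤
        1 + (args.map fun u => SH[φ, c, d, opVal gs i u]).sum := h1
    omega

/-- **The potential argument** for a fan-in-two formula `P`: for `i ≤ size`,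
`∑_{j<i} R_i(j)·N_j ≤ 3i`, where `R_i(j)` counts the references to gate `j` among the operands of
the gates `≥ i` and the output. [cite: HrubesYehudayoff2021, Lemma 12 / Thm. 1] -/
theorem potential_le (P : ArithCircuit ℝ≥0 σ) (hF : P.IsFormula) (hfan : P.IsFanInTwo) :
    ∀ i, i ≤ P.gates.length →
      ∑ j ∈ Finset.range i, ((P.gates.drop i).flatMap Gate.args ++ [P.output]).countP
        (Operand.refersTo j) * SH[φ, c, d, gateVal P.gates j] ≤ 3 * i := by
  intro i
  induction i with
  | zero => intro _; simp
  | succ i ih =>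
    intro hi
    have hi' : i < P.gates.length := hi
    set g := P.gates[i] with hgdef
    have hg : P.gates[i]? = some g := by rw [hgdef]; exact List.getElem?_eq_getElem hi'
    have hdrop : P.gates.drop i = g :: P.gates.drop (i + 1) := by
      rw [hgdef]; exact List.drop_eq_getElem_cons hi'
    have hR : ∀ j, ((P.gates.drop i).flatMap Gate.args ++ [P.output]).countP (Operand.refersTo j) =
        g.args.countP (Operand.refersTo j) +
          ((P.gates.drop (i + 1)).flatMap Gate.args ++ [P.output]).countP (Operand.refersTo j) := by
      intro j
      rw [hdrop, List.flatMap_cons, List.append_assoc, List.countP_append]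
    have hsub : List.Sublist ((P.gates.drop (i + 1)).flatMap Gate.args ++ [P.output])
        (P.gates.flatMap Gate.args ++ [P.output]) :=
      ((List.drop_sublist (i + 1) P.gates).flatMap Gate.args).append_right [P.output]
    have hR1 : ((P.gates.drop (i + 1)).flatMap Gate.args ++ [P.output]).countP
        (Operand.refersTo i) ≤ 1 :=
      hsub.countP_le.trans (hF i)
    have hgate := sh_gateVal_le φ c d P.gates hg (hfan g (hgdef ▸ List.getElem_mem hi'))
    have ih' := ih hi'.le
    simp_rw [hR, add_mul, Finset.sum_add_distrib] at ih'
    rw [Finset.sum_range_succ]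
    have hlast : ((P.gates.drop (i + 1)).flatMap Gate.args ++ [P.output]).countP
        (Operand.refersTo i) * SH[φ, c, d, gateVal P.gates i] ≤ SH[φ, c, d, gateVal P.gates i] := by
      calc _ ≤ 1 * SH[φ, c, d, gateVal P.gates i] := Nat.mul_le_mul_right _ hR1
        _ = _ := one_mul _
    omega

/-- **HY21 Lemma 12 / Theorem 1 for the tree's monotone formulas**: the polynomial computed by a
fan-in-two formula of size `s` over `ℝ≥0` has pencil count at most `3s + 1`, for every additive
`φ` and every pencil `(c, d)`. [cite: HrubesYehudayoff2021, Lemma 12 / Thm. 1] -/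
theorem sh_eval_le (P : ArithCircuit ℝ≥0 σ) (hF : P.IsFormula) (hfan : P.IsFanInTwo) :
    SH[φ, c, d, P.eval] ≤ 3 * P.size + 1 := by
  have hpot := potential_le φ c d P hF hfan P.gates.length le_rfl
  rw [List.drop_length, List.flatMap_nil, List.nil_append] at hpot
  change ∑ j ∈ Finset.range P.size, [P.output].countP (Operand.refersTo j) *
    SH[φ, c, d, gateVal P.gates j] ≤ 3 * P.size at hpot
  rw [eval_eq_opVal]
  change SH[φ, c, d, opVal P.gates P.size P.output] ≤ 3 * P.size + 1
  cases ho : P.output with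
  | var x => exact (sh_X_le φ c d x).trans (by omega)
  | const a => exact (sh_C_le φ c d a).trans (by omega)
  | gate m =>
    rw [opVal_gate]
    split_ifs with hm
    · rw [ho] at hpot
      have hterm : SH[φ, c, d, gateVal P.gates m] ≤
          ∑ j ∈ Finset.range P.size, [Operand.gate (k := ℝ≥0) (σ := σ) m].countP
            (Operand.refersTo j) * SH[φ, c, d, gateVal P.gates j] := by
        have hm' : m ∈ Finset.range P.size := Finset.mem_range.2 hm
        refine le_trans ?_ (Finset.single_le_sum (fun j _ => Nat.zero_le _) hm')
        simp [Operand.refersTo]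
      omega
    · rw [sh_zero]
      exact Nat.zero_le _

end Formula

end Summit.ValiantsHypothesis.ValiantsHypothesis.Theorems.DivisionGap.ShadowCofactorSplit

end
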